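import Summits.QuantumFields.YangMills.Theorems.UnitScaleTiltEXGuardedFiveOutright
import Summits.QuantumFields.YangMills.Theorems.UnitScaleTiltFluctuationComparisonRegPrIntLT8OfHalvingExist
import Summits.QuantumFields.YangMills.Theorems.UnitScaleTiltHistoryTailOfExistenceMinimalOrbitV4
import Summits.QuantumFields.YangMills.Theorems.FluctuationComparisonRegPrIntLWindowExactnessOfGapOrbitThm1
import HarnessLib

/-!
# Route `UnitScaleTilt` — [Balaban1985Variational] THM 1 (8) OUTRIGHT AT EVERY BLOCK SIZE `L ≥ 5`, AND THE `L = 3` RESIDUE ISOLATED: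
# every all-`L` consumer of the EX ∕ T8 letter (19936's registry door, the persistence leaf, 20520's EXW∘ door) needs ONLY its `L = 3` instance

Cell `ym3-torus` (YM ladder rung R3 = continuum `SU(2)` Yang–Mills on T³ — a RUNG, NOT d = 4, NOT infinite volume, NOT a mass gap, NOT Clay); seat `ym-line-cst-p1` g39
(free prover hand); `--supports stmt-QuantumFields-19936 --as helper`, count-neutral, definition-free, default heartbeats; registry ∕ route ∕ display untouched.

WHAT (compositions BY NAME of landed theorems; no analysis, no proof copied).
* §1 ★★★ `thm1In8GlobalMinAt_five (L) (h5 : 5 ≤ L) : ∃ a₀ a₁ B₃ > 0, Thm1GlobalMinAt L a₀ a₁ B₃ ∧ MinimisersIn8At L a₀ a₁ B₃` — **[Balaban1985Variational] THM 1 in the global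
  reading together with its (8)-clause, for the (0.4)-averaging `ℰp` on `SU(2)`, d = 3, at EVERY block size `L ≥ 5`, ZERO hypotheses**:
  ✓`IntLT8OfHalvingExist.thm1In8GlobalMinAt_of_halving_exist_L` fed by ✓`stub_halvingStep L` (Sect. F halving, p705908) and ✓`EXGuardedFiveOutright.exBody_guarded_five L`
  (Prop. 7's existence clause, px16 g16 p790882 over the guarded edition chain S01ᵍ–S55ᵍ); `exBody_allL_of_three`, `thm1In8_allL_of_three`, `thm1_allL_of_three` — the
  ALL-`L` letters (EX ∕ T8 ∕ Thm 1, as the registry rows and doors spell them: `∀ L, 1 < L → …` resp. `∀ L, Odd L → 1 < L → …`) from their `L = 3` INSTANCE ALONE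
  (odd `L > 1` is `3` or `≥ 5`; even `L` carries no family ∕ is excluded by `Odd`).
* §2 THE `L = 3` RESIDUE, BY NAME, for the three all-`L` consumers of record:
  ★★★ `historyTailL_of_existenceAtThree_selXsV4DataRows (hEX₃) (hrows) : HistoryTailL` and `historyTailL_of_thm1In8AtThree_selXsV4DataRows (hT8₃) (hrows)` — the crux
  stmt-QuantumFields-19936 AS REGISTERED (all `L`) ⟸ {its NODE-O row (O‴χₛ) `stub_selXsV4DataRows` VERBATIM, the row EX (resp. T8) AT `L = 3` ONLY}
  (✓`historyTailL_of_existenceMinimalOrbit_selXsV4DataRows_allL` ∕ ✓`historyTailL_of_thm1In8_selXsV4DataRows_allL`);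
  ★★ `windowExactnessExists_of_thm1AtThree (hT₃)` and ★★★ `windowExactness_of_gapOrbit_thm1AtThree (hGap) (hT₃)` — 20520's registry row EXW∘ (v11.4 text VERBATIM, w4 g19's
  ✓`windowExactness_of_gapOrbit_thm1`) ⟸ {GAP♯∘, Thm 1 AT `L = 3` ONLY}, its existence clause (2) ⟸ Thm 1 at `L = 3` alone;
  ★★ `ym3TorusSU2Adm_of_existenceAtThree_siblingRows (hEX₃) (h201) (hrows) : YM3TorusSU2Adm` — print's admissible-block leaf ⟸ {20520, (O‴χₛ), EX at `L = 3`} through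
  ✓`ym3TorusSU2Adm_of_siblings` (the companion file `…HistoryTailGuardedFive` removes even the `L = 3` letter from this leaf, block size by block size).

HONEST SCOPE (CREDIT NOTHING): plumbing; EX ∕ T8 ∕ Thm 1 AT `L = 3` (⟸ `hThm2S3`, [Balaban1985RegularSpaces] Thm 2 at `L = 3` — docket (5)), (O‴χₛ), GAP♯∘, EXW∘, 20520,
19936, 19200 AS REGISTERED and the leaf `YM3TorusSU2` are NOT proved; §1 is a THEOREM (modulo the tree's typed definitions) but closes no registered stub (the rows are
stated for all `L > 1`); registry №36 ∕ J-FREEZE untouched; rung R3 = SU(2) YM₃ on T³ — NOT d = 4, NOT infinite volume, NOT a mass gap, NOT Clay; the Yang–Mills mass gap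
is NOT proved.  Sorry-free, axioms standard.

References: T. Bałaban, CMP **102** (1985) 277–309 [Balaban1985Variational] (Thm 1 (8) p.279, Prop. 7 p.299, Prop. 8 p.304); CMP **102** (1985) 255–275 [Balaban1985UV3]
((5) p.256, (47) p.267, (67)–(71) p.273); CMP **109** (1987) 249–301 [Balaban1987RG1] (§0 p.251).
-/

set_option autoImplicit false

noncomputable section

namespace Summit.QuantumFields.YangMills.Theorems.Thm1GuardedFiveResidueThree

open MeasureTheory
open scoped Matrix.Norms.L2Operator
open Literature.MathematicalPhysics.QuantumFieldTheory.Balaban1983to89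
open Literature.MathematicalPhysics.QuantumFieldTheory.Balaban1983to89.T3ContinuumYM3Torus
open Literature.MathematicalPhysics.QuantumFieldTheory.Balaban1983to89.T3UnitLawDensityEML (ℰp)
open Literature.MathematicalPhysics.QuantumFieldTheory.Balaban1983to89.T3UnitScaleTilt
open Literature.MathematicalPhysics.QuantumFieldTheory.Balaban1983to89.T3TiltDescent
open Literature.MathematicalPhysics.QuantumFieldTheory.Balaban1983to89.T3PrintedRegularMinimiser
open Literature.MathematicalPhysics.QuantumFieldTheory.Balaban1983to89.T3PrintedMinimiserExistence (Thm1GlobalMinAt)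
open Literature.MathematicalPhysics.QuantumFieldTheory.Balaban1983to89.T3LowerAlongMinimisersSplit (MinimisersIn8At)
open Literature.MathematicalPhysics.QuantumFieldTheory.Balaban1983to89.T3ConstrainedMinimiser (fibre)
open Literature.MathematicalPhysics.QuantumFieldTheory.Balaban1983to89.ExpMeanLog (deltaSU)
open Literature.MathematicalPhysics.QuantumFieldTheory.Balaban1983to89.T3YM3TorusStatement (YM3TorusSU2Adm YM3TorusSU2At)
open Literature.MathematicalPhysics.QuantumFieldTheory.Balaban1985CMP102
open Literature.MathematicalPhysics.QuantumFieldTheory.Balaban1985CMP102.Setting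
open Summit.QuantumFields.Balaban3D.Carriers (suGroupModel)
open Summit.QuantumFields.Balaban3D.Proofs.Primitives (AlphaConsts)
open Summit.QuantumFields.Balaban3D.Proofs.Thresholds (Q0)
open B7Prop2Explicit (C0)
open Summit.QuantumFields.YangMills.Theses.UnitScaleTilt (FluctuationComparisonRegPrIntL HistoryTailL)
open Summit.QuantumFields.YangMills.Theorems
open Summit.QuantumFields.YangMills.Theorems.IntLT8OfHalvingExist (thm1In8GlobalMinAt_of_halving_exist_L)
open Summit.QuantumFields.YangMills.Theorems.MinimiserStabilityRegPrStubHalvingStep (stub_halvingStep)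
open Summit.QuantumFields.YangMills.Theorems.EXGuardedFiveOutright (exBody_guarded_five ym3TorusSU2Adm_of_siblings)
open Summit.QuantumFields.YangMills.Theorems.HistoryTailOfExistenceMinimalOrbit
  (historyTailL_of_existenceMinimalOrbit_selXsV4DataRows_allL)
open Summit.QuantumFields.YangMills.Theorems.HistoryTailLaneTailV4Chi (historyTailL_of_thm1In8_selXsV4DataRows_allL)
open Summit.QuantumFields.YangMills.Theorems.FluctuationComparisonRegPrIntLWindowExactnessOfGapOrbitThm1
  (windowExactnessExists_of_thm1 windowExactness_of_gapOrbit_thm1)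

/-! ## §1 ★★★ Thm 1 (8) OUTRIGHT at every `L ≥ 5`; the all-`L` letters from their `L = 3` instance -/

/-- ★★★ **[Balaban1985Variational] THM 1 (GLOBAL READING) WITH ITS (8)-CLAUSE AT EVERY BLOCK SIZE `L ≥ 5` — ZERO HYPOTHESES**: some `a₀, a₁, B₃ > 0` with
`Thm1GlobalMinAt L a₀ a₁ B₃ ∧ MinimisersIn8At L a₀ a₁ B₃`, from the halving ✓`stub_halvingStep L` and the existence clause ✓`exBody_guarded_five L` through
✓`thm1In8GlobalMinAt_of_halving_exist_L`. [cite: Balaban1985Variational, Thm 1 (8) p.279, Prop. 7 p.299, Prop. 8 p.304] -/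
theorem thm1In8GlobalMinAt_five (L : ℕ) (h5 : 5 ≤ L) :
    ∃ a₀ a₁ B₃ : ℝ, 0 < a₀ ∧ 0 < a₁ ∧ 0 < B₃ ∧ Thm1GlobalMinAt L a₀ a₁ B₃ ∧ MinimisersIn8At L a₀ a₁ B₃ :=
  thm1In8GlobalMinAt_of_halving_exist_L (by omega) (stub_halvingStep L (by omega)) (exBody_guarded_five L (by omega) h5)

/-- **THM 1 (GLOBAL READING) AT EVERY `L ≥ 5`, ZERO HYPOTHESES** (first conjunct of `thm1In8GlobalMinAt_five`). [cite: Balaban1985Variational, Thm 1 (8) p.279] -/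
theorem thm1GlobalMinAt_five (L : ℕ) (h5 : 5 ≤ L) : ∃ a₀ a₁ B₃ : ℝ, 0 < a₀ ∧ 0 < a₁ ∧ 0 < B₃ ∧ Thm1GlobalMinAt L a₀ a₁ B₃ := by
  obtain ⟨a₀, a₁, B₃, ha₀, ha₁, hB₃, hT, -⟩ := thm1In8GlobalMinAt_five L h5
  exact ⟨a₀, a₁, B₃, ha₀, ha₁, hB₃, hT⟩

/-- An odd block size `> 1` other than `3` is `≥ 5` (bookkeeping). [cite: Balaban1987RG1, §0 p.251] -/
theorem five_le_of_odd_of_ne_three {L : ℕ} (hLo : Odd L) (hL : 1 < L) (h3 : L ≠ 3) : 5 ≤ L := by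
  obtain ⟨m, rfl⟩ := hLo
  omega

/-- **THE ROW EX FOR ALL `L > 1` ⟸ ITS `L = 3` INSTANCE ALONE** (the registry text of 19200 v10 ∕ 19936 v6 `stub_existenceMinimalOrbit`, VERBATIM): `L = 3` from the
hypothesis, `L ≥ 5` by ✓`exBody_guarded_five`, even `L` vacuously (no `T3Family` has an even block size). [cite: Balaban1985Variational, Prop. 7 p.299 and (14) p.280] -/
theorem exBody_allL_of_three
    (hEX₃ : ∀ (B₃ : ℝ), 4 < B₃ → ∃ a₁' O₁ : ℝ, 0 < a₁' ∧ 1 ≤ O₁ ∧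
      ∀ (F : T3Family), F.L = 3 → ∀ (n K : ℕ) (hnK : n < K) (ε₁ : ℝ), 0 < ε₁ →
        ∀ V : GaugeField (F.P n) 0 (Matrix.specialUnitaryGroup (Fin 2) ℂ), PlaqSmall ε₁ V →
          ∀ U₀ : GaugeField (F.P K) 0 (Matrix.specialUnitaryGroup (Fin 2) ℂ), RegPr F n K (((3 : ℕ) : ℝ) ^ 3 * B₃ * ε₁) U₀ → U₀ ∈ fibre F ℰp n K hnK.le V →
            ε₁ ≤ a₁' → ∃ U ∈ regFibrePr F n K hnK.le (O₁ * ((3 : ℕ) : ℝ) ^ 3 * B₃ * ε₁) V,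
              IsMinOn (fun W : GaugeField (F.P K) 0 (Matrix.specialUnitaryGroup (Fin 2) ℂ) => wilsonAction4 W)
                (regFibrePr F n K hnK.le (O₁ * ((3 : ℕ) : ℝ) ^ 3 * B₃ * ε₁) V) U) :
    ∀ (L : ℕ), 1 < L → ∀ (B₃ : ℝ), 4 < B₃ → ∃ a₁' O₁ : ℝ, 0 < a₁' ∧ 1 ≤ O₁ ∧
      ∀ (F : T3Family), F.L = L → ∀ (n K : ℕ) (hnK : n < K) (ε₁ : ℝ), 0 < ε₁ →
        ∀ V : GaugeField (F.P n) 0 (Matrix.specialUnitaryGroup (Fin 2) ℂ), PlaqSmall ε₁ V →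
          ∀ U₀ : GaugeField (F.P K) 0 (Matrix.specialUnitaryGroup (Fin 2) ℂ), RegPr F n K ((L : ℝ) ^ 3 * B₃ * ε₁) U₀ → U₀ ∈ fibre F ℰp n K hnK.le V →
            ε₁ ≤ a₁' → ∃ U ∈ regFibrePr F n K hnK.le (O₁ * (L : ℝ) ^ 3 * B₃ * ε₁) V,
              IsMinOn (fun W : GaugeField (F.P K) 0 (Matrix.specialUnitaryGroup (Fin 2) ℂ) => wilsonAction4 W)
                (regFibrePr F n K hnK.le (O₁ * (L : ℝ) ^ 3 * B₃ * ε₁) V) U := by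
  intro L hL B₃ hB₃
  by_cases h3 : L = 3
  · subst h3
    exact hEX₃ B₃ hB₃
  by_cases hLo : Odd L
  · exact exBody_guarded_five L hL (five_le_of_odd_of_ne_three hLo hL h3) B₃ hB₃
  · refine ⟨1, 1, one_pos, le_rfl, fun F hFL => ?_⟩
    exact absurd (hFL ▸ F.hL.1) hLo

/-- **THE ROW T8 (Thm 1 ∧ (8)) FOR ALL ODD `L > 1` ⟸ ITS `L = 3` INSTANCE ALONE** (`L ≥ 5` by `thm1In8GlobalMinAt_five`). [cite: Balaban1985Variational, Thm 1 (8) p.279 and Prop. 8 p.304] -/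
theorem thm1In8_allL_of_three (hT8₃ : ∃ a₀ a₁ B₃ : ℝ, 0 < a₀ ∧ 0 < a₁ ∧ 0 < B₃ ∧ Thm1GlobalMinAt 3 a₀ a₁ B₃ ∧ MinimisersIn8At 3 a₀ a₁ B₃) :
    ∀ L : ℕ, Odd L → 1 < L → ∃ a₀ a₁ B₃ : ℝ, 0 < a₀ ∧ 0 < a₁ ∧ 0 < B₃ ∧ Thm1GlobalMinAt L a₀ a₁ B₃ ∧ MinimisersIn8At L a₀ a₁ B₃ := by
  intro L hLo hL
  by_cases h3 : L = 3
  · subst h3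
    exact hT8₃
  · exact thm1In8GlobalMinAt_five L (five_le_of_odd_of_ne_three hLo hL h3)

/-- **THE THM-1 LETTER FOR ALL ODD `L > 1` ⟸ ITS `L = 3` INSTANCE ALONE** (`L ≥ 5` by `thm1GlobalMinAt_five`). [cite: Balaban1985Variational, Thm 1 (8) p.279] -/
theorem thm1_allL_of_three (hT₃ : ∃ a₀ a₁ B₃ : ℝ, 0 < a₀ ∧ 0 < a₁ ∧ 0 < B₃ ∧ Thm1GlobalMinAt 3 a₀ a₁ B₃) :
    ∀ L : ℕ, Odd L → 1 < L → ∃ a₀ a₁ B₃ : ℝ, 0 < a₀ ∧ 0 < a₁ ∧ 0 < B₃ ∧ Thm1GlobalMinAt L a₀ a₁ B₃ := by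
  intro L hLo hL
  by_cases h3 : L = 3
  · subst h3
    exact hT₃
  · exact thm1GlobalMinAt_five L (five_le_of_odd_of_ne_three hLo hL h3)

/-! ## §2 The `L = 3` residue, by name, for the three all-`L` consumers of record -/

/-- ★★★ **THE CRUX `HistoryTailL` (stmt-QuantumFields-19936) AS REGISTERED (ALL `L`) ⟸ {ITS NODE-O ROW (O‴χₛ) VERBATIM, THE ROW EX AT `L = 3` ONLY}** — the registry door
✓`historyTailL_of_existenceMinimalOrbit_selXsV4DataRows_allL` with its EX binder fed by `exBody_allL_of_three`; `hrows` = `unbundled_v6.lean`'s `stub_selXsV4DataRows` TYPE VERBATIM.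
[cite: Balaban1985UV3, (5) p.256, (47) p.267 and (67)–(71) p.273; Balaban1985Variational, Thm 1 (8) p.279 and Prop. 7 p.299] -/
theorem historyTailL_of_existenceAtThree_selXsV4DataRows
    (hEX₃ : ∀ (B₃ : ℝ), 4 < B₃ → ∃ a₁' O₁ : ℝ, 0 < a₁' ∧ 1 ≤ O₁ ∧
      ∀ (F : T3Family), F.L = 3 → ∀ (n K : ℕ) (hnK : n < K) (ε₁ : ℝ), 0 < ε₁ →
        ∀ V : GaugeField (F.P n) 0 (Matrix.specialUnitaryGroup (Fin 2) ℂ), PlaqSmall ε₁ V →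
          ∀ U₀ : GaugeField (F.P K) 0 (Matrix.specialUnitaryGroup (Fin 2) ℂ), RegPr F n K (((3 : ℕ) : ℝ) ^ 3 * B₃ * ε₁) U₀ → U₀ ∈ fibre F ℰp n K hnK.le V →
            ε₁ ≤ a₁' → ∃ U ∈ regFibrePr F n K hnK.le (O₁ * ((3 : ℕ) : ℝ) ^ 3 * B₃ * ε₁) V,
              IsMinOn (fun W : GaugeField (F.P K) 0 (Matrix.specialUnitaryGroup (Fin 2) ℂ) => wilsonAction4 W)
                (regFibrePr F n K hnK.le (O₁ * ((3 : ℕ) : ℝ) ^ 3 * B₃ * ε₁) V) U)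
    (hrows : ∀ L : ℕ, Odd L → 1 < L → ∃ (B₀ A₀ A₁ : ℝ), 0 < A₀ ∧ 0 < A₁ ∧
      ∀ (B a₀ a₁ : ℝ), B₀ ≤ B → 1 ≤ 2 * B → 0 < a₀ → a₀ ≤ A₀ → 0 < a₁ → a₁ ≤ A₁ → B * a₁ ≤ a₀ →
        (143 * ((((3 + 4 : ℕ) : ℝ)) ^ 2 / 4) ^ 2) * (2 * (B * a₁)) ≤ 1 / 3 →
        2 * (2 * (B * a₁)) ≤ 2 * deltaSU (Fin 2) / (((3 + 4) * L : ℕ) : ℝ) ^ 2 →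
        Thm1GlobalMinAt L a₀ a₁ B →
        ∃ (b₁ p₁ : ℝ), ∀ (b₀ p₀ : ℝ), b₁ ≤ b₀ → p₁ ≤ p₀ →
          ∃ 𝔠 : AlphaConsts L (suGroupModel 2).N, 𝔠.b₀ = b₀ ∧ 𝔠.p₀ = p₀ ∧ 𝔠.B₃ = B ∧
            4 * 𝔠.B₃ * (L : ℝ) ^ 2 * avgWindowFactor L ≤ 𝔠.C68 ∧
            Real.exp (𝔠.p₀ - 1) ≤ 3 * C0 3 * 𝔠.C68 * (𝔠.b₀ * Q0 𝔠.p₀) ∧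
            (𝔠.b₀ * Q0 𝔠.p₀) * (2 * (L : ℝ) ^ 2 * avgWindowFactor L) ^ 2 ≤ 3 * C0 3 * 𝔠.C68 * a₁ ^ 2 ∧
            ∀ (F : T3Family) (hF : F.L = L),
              (∀ (γ : ℝ) (hγ : 0 < γ) (hγ1 : γ ≤ (min (hF ▸ 𝔠).gamma0 1) ^ 2) (K : ℕ),
                AlphaInputsT3AC.SmallFactor71OfRecT3 F (hF ▸ 𝔠) γ hγ hγ1 K) ∧
              ∀ (γ : ℝ) (hγ : 0 < γ) (hγ1 : γ ≤ (min (hF ▸ 𝔠).gamma0 1) ^ 2) (K : ℕ),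
                (∃ Ut : (k : ℕ) → GaugeField (F.P K) k (Matrix.specialUnitaryGroup (Fin 2) ℂ) →
                    GaugeField (F.P K) 0 (Matrix.specialUnitaryGroup (Fin 2) ℂ),
                  AlphaInputsT3AC.TrivMinimiserRowsT3 F (hF ▸ 𝔠) γ hγ hγ1 a₀ a₁ K Ut) →
                ∃ Ut : (k : ℕ) → GaugeField (F.P K) k (Matrix.specialUnitaryGroup (Fin 2) ℂ) →
                    GaugeField (F.P K) 0 (Matrix.specialUnitaryGroup (Fin 2) ℂ),
                  AlphaInputsT3AC.TrivMinimiserRowsT3 F (hF ▸ 𝔠) γ hγ hγ1 a₀ a₁ K Ut ∧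
                    AlphaInputsT3AC.DataRowsT3XsChiSel F (hF ▸ 𝔠) γ hγ hγ1 K Ut) :
    HistoryTailL :=
  historyTailL_of_existenceMinimalOrbit_selXsV4DataRows_allL (exBody_allL_of_three hEX₃) hrows

/-- **`HistoryTailL` AS REGISTERED ⟸ {(O‴χₛ) VERBATIM, T8 AT `L = 3` ONLY}** (✓`historyTailL_of_thm1In8_selXsV4DataRows_allL` ∘ `thm1In8_allL_of_three`).
[cite: Balaban1985UV3, (5) p.256 and (67)–(71) p.273; Balaban1985Variational, Thm 1 (8) p.279] -/
theorem historyTailL_of_thm1In8AtThree_selXsV4DataRows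
    (hT8₃ : ∃ a₀ a₁ B₃ : ℝ, 0 < a₀ ∧ 0 < a₁ ∧ 0 < B₃ ∧ Thm1GlobalMinAt 3 a₀ a₁ B₃ ∧ MinimisersIn8At 3 a₀ a₁ B₃)
    (hrows : ∀ L : ℕ, Odd L → 1 < L → ∃ (B₀ A₀ A₁ : ℝ), 0 < A₀ ∧ 0 < A₁ ∧
      ∀ (B a₀ a₁ : ℝ), B₀ ≤ B → 1 ≤ 2 * B → 0 < a₀ → a₀ ≤ A₀ → 0 < a₁ → a₁ ≤ A₁ → B * a₁ ≤ a₀ →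
        (143 * ((((3 + 4 : ℕ) : ℝ)) ^ 2 / 4) ^ 2) * (2 * (B * a₁)) ≤ 1 / 3 →
        2 * (2 * (B * a₁)) ≤ 2 * deltaSU (Fin 2) / (((3 + 4) * L : ℕ) : ℝ) ^ 2 →
        Thm1GlobalMinAt L a₀ a₁ B →
        ∃ (b₁ p₁ : ℝ), ∀ (b₀ p₀ : ℝ), b₁ ≤ b₀ → p₁ ≤ p₀ →
          ∃ 𝔠 : AlphaConsts L (suGroupModel 2).N, 𝔠.b₀ = b₀ ∧ 𝔠.p₀ = p₀ ∧ 𝔠.B₃ = B ∧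
            4 * 𝔠.B₃ * (L : ℝ) ^ 2 * avgWindowFactor L ≤ 𝔠.C68 ∧
            Real.exp (𝔠.p₀ - 1) ≤ 3 * C0 3 * 𝔠.C68 * (𝔠.b₀ * Q0 𝔠.p₀) ∧
            (𝔠.b₀ * Q0 𝔠.p₀) * (2 * (L : ℝ) ^ 2 * avgWindowFactor L) ^ 2 ≤ 3 * C0 3 * 𝔠.C68 * a₁ ^ 2 ∧
            ∀ (F : T3Family) (hF : F.L = L),
              (∀ (γ : ℝ) (hγ : 0 < γ) (hγ1 : γ ≤ (min (hF ▸ 𝔠).gamma0 1) ^ 2) (K : ℕ),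
                AlphaInputsT3AC.SmallFactor71OfRecT3 F (hF ▸ 𝔠) γ hγ hγ1 K) ∧
              ∀ (γ : ℝ) (hγ : 0 < γ) (hγ1 : γ ≤ (min (hF ▸ 𝔠).gamma0 1) ^ 2) (K : ℕ),
                (∃ Ut : (k : ℕ) → GaugeField (F.P K) k (Matrix.specialUnitaryGroup (Fin 2) ℂ) →
                    GaugeField (F.P K) 0 (Matrix.specialUnitaryGroup (Fin 2) ℂ),
                  AlphaInputsT3AC.TrivMinimiserRowsT3 F (hF ▸ 𝔠) γ hγ hγ1 a₀ a₁ K Ut) →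
                ∃ Ut : (k : ℕ) → GaugeField (F.P K) k (Matrix.specialUnitaryGroup (Fin 2) ℂ) →
                    GaugeField (F.P K) 0 (Matrix.specialUnitaryGroup (Fin 2) ℂ),
                  AlphaInputsT3AC.TrivMinimiserRowsT3 F (hF ▸ 𝔠) γ hγ hγ1 a₀ a₁ K Ut ∧
                    AlphaInputsT3AC.DataRowsT3XsChiSel F (hF ▸ 𝔠) γ hγ hγ1 K Ut) :
    HistoryTailL :=
  historyTailL_of_thm1In8_selXsV4DataRows_allL (thm1In8_allL_of_three hT8₃) hrows

/-- ★★ **20520's REGISTRY ROW EXW∘, EXISTENCE CLAUSE (2) ONLY (prefix VERBATIM, all `L`) ⟸ THM 1 AT `L = 3` ALONE** (w4 g19's ✓`windowExactnessExists_of_thm1` ∘ `thm1_allL_of_three`).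
[cite: Balaban1985Variational, Thm 1 (8) p.279 and Prop 7 p.299] -/
theorem windowExactnessExists_of_thm1AtThree (hT₃ : ∃ a₀ a₁ B₃ : ℝ, 0 < a₀ ∧ 0 < a₁ ∧ 0 < B₃ ∧ Thm1GlobalMinAt 3 a₀ a₁ B₃) :
    ∀ (L : ℕ), ∃ c₀ : ℝ, 0 < c₀ ∧ c₀ ≤ 1 ∧ ∀ (cw : ℝ), 0 < cw → cw ≤ c₀ → ∃ pS : ℝ, ∀ (b₀ p₀ : ℝ), 0 < b₀ → pS ≤ p₀ → 0 < p₀ →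
      ∃ ε₁ : ℝ, 0 < ε₁ ∧ ∀ (ε₀ : ℝ), 0 < ε₀ → ε₀ ≤ ε₁ →
      ∃ γ₁ : ℝ, 0 < γ₁ ∧ ∀ (F : T3Family) (γ : ℝ), F.L = L → 0 < γ → γ ≤ γ₁ →
        ∀ (J K : ℕ) (hJK : J ≤ K) (V : GaugeField (F.P J) 0 (Matrix.specialUnitaryGroup (Fin 2) ℂ)), PlaqSmall (θBal F.L γ (cw * b₀) p₀ J) V →
          ∃ U₀ ∈ regFibrePr F J K hJK ε₀ V, U₀ ∈ histGood F ℰp (θBal F.L γ b₀ p₀) K J ∧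
            wilsonAction4 U₀ = minActionRegPr F J K hJK ε₀ V :=
  windowExactnessExists_of_thm1 (thm1_allL_of_three hT₃)

/-- ★★★ **20520's REGISTRY ROW EXW∘ (v11.4 `WindowExactness` TEXT VERBATIM, all `L`) ⟸ {GAP♯∘ (v11.4 `UniformFibreGapOrbit` text with the two RG-K substitutions, as in w4 g19's
door), THM 1 AT `L = 3` ONLY}** (✓`windowExactness_of_gapOrbit_thm1` ∘ `thm1_allL_of_three`). [cite: Balaban1985Variational, Thm 1 (8)-(10) p.279 and (142) p.299] -/
theorem windowExactness_of_gapOrbit_thm1AtThree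
    (hGap : ∀ (L : ℕ), ∃ c₀ : ℝ, 0 < c₀ ∧ c₀ ≤ 1 ∧ ∀ (cw : ℝ), 0 < cw → cw ≤ c₀ → ∃ pS : ℝ, ∀ (b₀ p₀ : ℝ), 0 < b₀ → pS ≤ p₀ → 0 < p₀ →
      ∃ ε₁ : ℝ, 0 < ε₁ ∧ ∀ (ε₀ : ℝ), 0 < ε₀ → ε₀ ≤ ε₁ →
      ∃ γ₁ : ℝ, 0 < γ₁ ∧ ∃ μ : ℝ, 0 < μ ∧ ∀ (F : T3Family) (γ : ℝ), F.L = L → 0 < γ → γ ≤ γ₁ →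
        ∀ (J K : ℕ) (hJK : J ≤ K) (V : GaugeField (F.P J) 0 (Matrix.specialUnitaryGroup (Fin 2) ℂ)), PlaqSmall (θBal F.L γ (cw * b₀) p₀ J) V →
          ∀ U₀ ∈ {U' | U' ∈ fibre F ℰp J K hJK V ∧ U' ∈ histGood F ℰp (θBal F.L γ b₀ p₀) K J ∧
              wilsonAction4 U' = minActionRegPr F J K hJK ε₀ V},
            ∀ U ∈ fibre F ℰp J K hJK V, U ∈ histGood F ℰp (θBal F.L γ b₀ p₀) K J →
              μ * ((F.L : ℝ)⁻¹) ^ (2 * (K - J)) *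
                  (⨅ w : {w : Site (F.P K) 0 → Matrix.specialUnitaryGroup (Fin 2) ℂ |
                      ∀ U : GaugeField (F.P K) 0 (Matrix.specialUnitaryGroup (Fin 2) ℂ),
                        descendTo F ℰp J K hJK (GaugeField.gaugeAct w U) = descendTo F ℰp J K hJK U},
                    ∑ ℓ : PBond (F.P K) 0,
                      dist1 (U ℓ * ((GaugeField.gaugeAct (w : Site (F.P K) 0 → Matrix.specialUnitaryGroup (Fin 2) ℂ) U₀) ℓ)⁻¹) ^ 2)
                ≤ wilsonAction4 U - minActionRegPr F J K hJK ε₀ V)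
    (hT₃ : ∃ a₀ a₁ B₃ : ℝ, 0 < a₀ ∧ 0 < a₁ ∧ 0 < B₃ ∧ Thm1GlobalMinAt 3 a₀ a₁ B₃) :
    ∀ (L : ℕ), ∃ c₀ : ℝ, 0 < c₀ ∧ c₀ ≤ 1 ∧ ∀ (cw : ℝ), 0 < cw → cw ≤ c₀ → ∃ pS : ℝ, ∀ (b₀ p₀ : ℝ), 0 < b₀ → pS ≤ p₀ → 0 < p₀ → ∃ ε₁ : ℝ, 0 < ε₁ ∧ ∀ (ε₀ : ℝ), 0 < ε₀ → ε₀ ≤ ε₁ →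
    ∃ γ₁ : ℝ, 0 < γ₁ ∧ ∀ (F : T3Family) (γ : ℝ), F.L = L → 0 < γ → γ ≤ γ₁ →
      ∀ (J K : ℕ) (hJK : J ≤ K) (V : GaugeField (F.P J) 0 (Matrix.specialUnitaryGroup (Fin 2) ℂ)), PlaqSmall (θBal F.L γ (cw * b₀) p₀ J) V →
        (∀ U ∈ fibre F ℰp J K hJK V, U ∈ histGood F ℰp (θBal F.L γ b₀ p₀) K J →
            minActionRegPr F J K hJK ε₀ V ≤ wilsonAction4 U) ∧
        (∃ U₀ ∈ regFibrePr F J K hJK ε₀ V, U₀ ∈ histGood F ℰp (θBal F.L γ b₀ p₀) K J ∧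
            wilsonAction4 U₀ = minActionRegPr F J K hJK ε₀ V) :=
  windowExactness_of_gapOrbit_thm1 hGap (thm1_allL_of_three hT₃)

/-- ★★ **PRINT's ADMISSIBLE-BLOCK LEAF ⟸ {20520 BY NAME, (O‴χₛ) VERBATIM, EX AT `L = 3`}** (✓`ym3TorusSU2Adm_of_siblings` with `HistoryTailL` fed by
`historyTailL_of_existenceAtThree_selXsV4DataRows`; the companion `…HistoryTailGuardedFive.ym3TorusSU2Adm_of_intL_selXsV4DataRows` drops even the `L = 3` letter).
[cite: Balaban1987RG1, §0 p.251; Balaban1985UV3, (1)-(3) p.256 and (67)–(71) p.273; Balaban1985Variational, Prop. 7 p.299] -/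
theorem ym3TorusSU2Adm_of_existenceAtThree_siblingRows
    (hEX₃ : ∀ (B₃ : ℝ), 4 < B₃ → ∃ a₁' O₁ : ℝ, 0 < a₁' ∧ 1 ≤ O₁ ∧
      ∀ (F : T3Family), F.L = 3 → ∀ (n K : ℕ) (hnK : n < K) (ε₁ : ℝ), 0 < ε₁ →
        ∀ V : GaugeField (F.P n) 0 (Matrix.specialUnitaryGroup (Fin 2) ℂ), PlaqSmall ε₁ V →
          ∀ U₀ : GaugeField (F.P K) 0 (Matrix.specialUnitaryGroup (Fin 2) ℂ), RegPr F n K (((3 : ℕ) : ℝ) ^ 3 * B₃ * ε₁) U₀ → U₀ ∈ fibre F ℰp n K hnK.le V →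
            ε₁ ≤ a₁' → ∃ U ∈ regFibrePr F n K hnK.le (O₁ * ((3 : ℕ) : ℝ) ^ 3 * B₃ * ε₁) V,
              IsMinOn (fun W : GaugeField (F.P K) 0 (Matrix.specialUnitaryGroup (Fin 2) ℂ) => wilsonAction4 W)
                (regFibrePr F n K hnK.le (O₁ * ((3 : ℕ) : ℝ) ^ 3 * B₃ * ε₁) V) U)
    (h201 : FluctuationComparisonRegPrIntL)
    (hrows : ∀ L : ℕ, Odd L → 1 < L → ∃ (B₀ A₀ A₁ : ℝ), 0 < A₀ ∧ 0 < A₁ ∧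
      ∀ (B a₀ a₁ : ℝ), B₀ ≤ B → 1 ≤ 2 * B → 0 < a₀ → a₀ ≤ A₀ → 0 < a₁ → a₁ ≤ A₁ → B * a₁ ≤ a₀ →
        (143 * ((((3 + 4 : ℕ) : ℝ)) ^ 2 / 4) ^ 2) * (2 * (B * a₁)) ≤ 1 / 3 →
        2 * (2 * (B * a₁)) ≤ 2 * deltaSU (Fin 2) / (((3 + 4) * L : ℕ) : ℝ) ^ 2 →
        Thm1GlobalMinAt L a₀ a₁ B →
        ∃ (b₁ p₁ : ℝ), ∀ (b₀ p₀ : ℝ), b₁ ≤ b₀ → p₁ ≤ p₀ →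
          ∃ 𝔠 : AlphaConsts L (suGroupModel 2).N, 𝔠.b₀ = b₀ ∧ 𝔠.p₀ = p₀ ∧ 𝔠.B₃ = B ∧
            4 * 𝔠.B₃ * (L : ℝ) ^ 2 * avgWindowFactor L ≤ 𝔠.C68 ∧
            Real.exp (𝔠.p₀ - 1) ≤ 3 * C0 3 * 𝔠.C68 * (𝔠.b₀ * Q0 𝔠.p₀) ∧
            (𝔠.b₀ * Q0 𝔠.p₀) * (2 * (L : ℝ) ^ 2 * avgWindowFactor L) ^ 2 ≤ 3 * C0 3 * 𝔠.C68 * a₁ ^ 2 ∧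
            ∀ (F : T3Family) (hF : F.L = L),
              (∀ (γ : ℝ) (hγ : 0 < γ) (hγ1 : γ ≤ (min (hF ▸ 𝔠).gamma0 1) ^ 2) (K : ℕ),
                AlphaInputsT3AC.SmallFactor71OfRecT3 F (hF ▸ 𝔠) γ hγ hγ1 K) ∧
              ∀ (γ : ℝ) (hγ : 0 < γ) (hγ1 : γ ≤ (min (hF ▸ 𝔠).gamma0 1) ^ 2) (K : ℕ),
                (∃ Ut : (k : ℕ) → GaugeField (F.P K) k (Matrix.specialUnitaryGroup (Fin 2) ℂ) →
                    GaugeField (F.P K) 0 (Matrix.specialUnitaryGroup (Fin 2) ℂ),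
                  AlphaInputsT3AC.TrivMinimiserRowsT3 F (hF ▸ 𝔠) γ hγ hγ1 a₀ a₁ K Ut) →
                ∃ Ut : (k : ℕ) → GaugeField (F.P K) k (Matrix.specialUnitaryGroup (Fin 2) ℂ) →
                    GaugeField (F.P K) 0 (Matrix.specialUnitaryGroup (Fin 2) ℂ),
                  AlphaInputsT3AC.TrivMinimiserRowsT3 F (hF ▸ 𝔠) γ hγ hγ1 a₀ a₁ K Ut ∧
                    AlphaInputsT3AC.DataRowsT3XsChiSel F (hF ▸ 𝔠) γ hγ hγ1 K Ut) :
    YM3TorusSU2Adm :=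
  ym3TorusSU2Adm_of_siblings h201 (historyTailL_of_existenceAtThree_selXsV4DataRows hEX₃ hrows)

end Summit.QuantumFields.YangMills.Theorems.Thm1GuardedFiveResidueThree

end
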